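import Summits.BirchSwinnertonDyer.BirchSwinnertonDyer.Theorems.GenusKolyvaginAtTwoShaCorestrictionQuadratic
import Summits.BirchSwinnertonDyer.BirchSwinnertonDyer.Theorems.GenusKolyvaginAtTwoGenusDeepSupplyAtTwoNegDiscNarrowKFourCellShaStructure
import HarnessLib

/-!
# Route `GenusKolyvaginAtTwo` — THE K₄/K₄⁺ CONSISTENCY LAW `#Ш(E/K)[2^∞] = #Ш(E/ℚ)[2^∞]` WITHOUT CASSELS–TATE ADJOINTNESS,
# and the common one-block structure `Ш(E_K/K)[2^∞] ≃ Ш(E/ℚ)[2^∞] ≃ (ℤ/2^e)²` on cells with a capitulating class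

Seat `bsd-line-gk2-p4` g29 (cell `bsd-f1-sign2`), WIDTH-5 attach on route `GenusKolyvaginAtTwo` rev 59; sequel of the lineage's
`…ShaCardDvdPowAtTwoPosTDefectOneBitLaw{,Exact,Kernel}` (g27: p767735 / p767964 / p768230) and `…ShaCorestrictionQuadratic` (g28: p771202,
`corBaseChange_mem_sha` — the cor binders discharged).  THEOREMS ONLY (no definition, no named fact, no `sorry`); standard axioms.
**BSD is NOT proved by this file; K4Neg / K4Pos / 23491 / 25504 are NOT proved; no item is closed.**

WHAT.  g28 left the ★ consistency law `ShaCores.natCard_shaPrimary_eq_natCard_shaPrimary_rat_of_adjoint_of_kramerClass_mem_of_frame`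
(`#Ш(E/K)[2^∞] = #Ш(E/ℚ)[2^∞]` on a one-block cell of the pair-sandwich frame where a non-zero `2`-primary class of `Ш(E/ℚ)` capitulates
in `K` — the K₄ / K₄⁺ cells of cruxes 23491 / 25504) conditional on ONE named print fact, `casselsTate_pairing_resCor` (Fisher 2003
Prop. 2.16: `res`/`cor` adjoint for the Cassels–Tate pairing; `hRC`).  Here `hRC` is REMOVED.  Write `X = Ш(E_K/K)[2^∞]`, `Y = Ш(E/ℚ)[2^∞]`.
* §1 `natCard_le_two_mul_natCard_map_shaRestriction_of_frame` — on the frame (`[K:ℚ] = 2`, `τ ≠ 1`, `E(K)[2] = 0`, `rank E(K) ≤ 1`,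
  `y ∈ E(K)` with `τy + y` torsion and `2^(M+1) ∤ y`) EVERY finite subgroup `S ≤ Ш(E/ℚ)` has `#S ≤ 2 · #res(S)`: the kernel of
  `res : H¹(ℚ, E) → H¹(K, E_K)` has at most one non-zero class (g27 `OneBit.eq_of_resBaseChange_eq_zero_of_frame`, UNCONDITIONAL).
  Hence `#Y ≤ 2 · #X` (`natCard_shaPrimary_rat_le_two_mul_natCard_shaPrimary_of_frame`) and `#Ш(E/ℚ)[2] ≤ 2 · #Ш(E_K/K)[2]`.
* §2 ★ `natCard_shaPrimary_eq_natCard_shaPrimary_rat_of_kramerClass_mem_of_frame` — **`#Ш(E/K)[2^∞] = #Ш(E/ℚ)[2^∞]`, `hRC`-FREE**: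
  `#Y ≤ 2·#X` (§1) and `2·#X ≤ #X[2]·#Y = 4·#Y` (g27 `OneBit.two_mul_natCard_shaPrimary_le_of_kramerClass_mem`, cor binders by g28) with
  `#X = 4^t`, `#Y = 4^a` (Cassels–Tate over `K` and over `ℚ`, tree theorems) force `a ≤ t ≤ a` by PARITY of the exponents
  (`4^a ≤ 2·4^t ⟹ a ≤ t`, `2·4^t ≤ 4·4^a ⟹ t ≤ a`).  Fisher 2.16 gave `#Y ≤ #X`; the factor `2` it saved is invisible to powers of `4`.
* §3 `exists_addEquiv_shaPrimary_prod_of_kramerClass_mem_of_frame` — on the same cells BOTH groups are ONE Kolyvagin–McCallum block of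
  the SAME size: `∃ e ≥ 1`, `X ≃ ℤ/2^e × ℤ/2^e`, `Y ≃ ℤ/2^e × ℤ/2^e`, `#X = #Y = 4^e`, and `#Ш(E/ℚ)[2] = 4`
  (hyperbolicity of both `2`-primary parts + `#X[2] = 4` + §1 on the `2`-torsion + §2).
* (sequel `…ShaConsistencyLawFreeCurrency`) currency lemmas for the pen's Kolyvagin-free restatement of K₄/K₄⁺ (LEAD-BRIEF-g23-ADDENDUM
  B.3): `2^m · Ш(E/ℚ)[2^∞] = 0 ↔ 2^m · Ш(E_K/K)[2^∞] = 0` and a class of order `2^e` in `Ш(E/ℚ)[2^∞]` with `#Ш(E_K/K)[2^∞] = 4^e`.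
What is NOT bypassed: the case-A law `#X = 4·#Y` (no capitulation; LINE 24's K₄⁼² cell, `…OneBitLawExact` §3) still needs `hRC` — there
the parity argument leaves `#X/#Y ∈ {1, 4}` undecided.

References: [Kramer1981] Thm. 1, Prop. 7, Thm. 2; [Cassels1962ArithmeticIV] §1; [Wall1963QuadraticFormsFiniteGroups] Lemma 7;
[SilvermanAEC2009] Thm. X.4.14; [GrossLMS1991] §5 Prop. 5.3; [McCallumLMS1991] §5; [SerreGaloisCohomology1997] I §2.4 Prop. 9.
-/

set_option autoImplicit false
set_option linter.dupNamespace false -- `Summit.<P>.<Sub>` repeats `BirchSwinnertonDyer` (D-0017)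

noncomputable section

open scoped Classical

namespace Summit.BirchSwinnertonDyer.BirchSwinnertonDyer.Theorems.GenusExact.ShaCores

open WeierstrassCurve NumberField IsDedekindDomain Field AddSubgroup Literature.NumberTheory.EllipticCurves
  Literature.NumberTheory.GaloisRepresentations
open Summit.BirchSwinnertonDyer.BirchSwinnertonDyer.Theorems.GenusExact.PlusDescent
open Summit.BirchSwinnertonDyer.BirchSwinnertonDyer.Theorems.GenusExact.PlusDescent.OneBit
open Summit.BirchSwinnertonDyer.BirchSwinnertonDyer.Theorems.GenusSupplyNarrow (KFourCell.exists_addEquiv_zmod_prod_zmod_of_natCard_torsionBy_two_eq_four)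

variable (W : WeierstrassCurve ℚ) [W.IsElliptic] (K : Type) [Field K] [NumberField K]

/-! ## §0 Two counting helpers -/

/-- Powers of `4` compare up to a factor `2`: `4^a ≤ 2·4^t ⟹ a ≤ t` (parity of the exponent of `2`). [folklore] -/
theorem le_of_pow_four_le_two_mul_pow_four {a t : ℕ} (h : 2 ^ (2 * a) ≤ 2 * 2 ^ (2 * t)) : a ≤ t := by
  have h' : 2 ^ (2 * a) ≤ 2 ^ (2 * t + 1) := by rw [pow_succ']; exact h
  have := (Nat.pow_le_pow_iff_right (by norm_num)).mp h'
  omega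

/-- A non-zero element of `2`-power order has a non-zero multiple killed by `2`. [folklore] -/
theorem exists_nsmul_ne_zero_two_nsmul_eq_zero {G : Type*} [AddCommGroup G] {g : G} (hg : g ≠ 0) {k : ℕ} (hk : 2 ^ k • g = 0) :
    ∃ j : ℕ, 2 ^ j • g ≠ 0 ∧ 2 • (2 ^ j • g) = 0 := by
  classical
  have hex : ∃ n : ℕ, 2 ^ n • g = 0 := ⟨k, hk⟩
  set n := Nat.find hex with hn
  have hn0 : 2 ^ n • g = 0 := Nat.find_spec hex
  have hnpos : 0 < n := by
    by_contra h0
    have : n = 0 := by omega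
    rw [this, pow_zero, one_smul] at hn0
    exact hg hn0
  refine ⟨n - 1, fun h ↦ ?_, ?_⟩
  · have := Nat.find_min hex (m := n - 1) (by omega)
    exact this h
  · rw [← mul_nsmul', ← pow_succ', Nat.sub_add_cancel hnpos, hn0]

/-! ## §1 `#S ≤ 2 · #res(S)` for every finite subgroup of `Ш(E/ℚ)`, on the frame (unconditional) -/

section Frame

/-- **`#S ≤ 2 · #res(S)` for every finite subgroup `S ≤ Ш(E/ℚ)`** on the pair-sandwich frame (`[K:ℚ] = 2`, `τ ≠ 1`, `E(K)[2] = 0`,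
`rank E(K) ≤ 1`, `y ∈ E(K)` with `τy + y` torsion and `2^(M+1) ∤ y`): the kernel of `res : H¹(ℚ, E) → H¹(K, E_K)` has at most ONE
non-zero class (g27 `OneBit.eq_of_resBaseChange_eq_zero_of_frame` — Kummer theory on the frame, unconditional), so `#ker(res|_S) ≤ 2`
and `#S = #ker · #res(S)`. [cite: Kramer1981, Thm. 1, Prop. 7] [cite: GrossLMS1991, §5 Prop. 5.3] [cite: SerreGaloisCohomology1997, I §2.4 Prop. 9] -/
theorem natCard_le_two_mul_natCard_map_shaRestriction_of_frame (h2 : Module.finrank ℚ K = 2) {τ : K ≃ₐ[ℚ] K} (hτ : τ ≠ 1)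
    (h2tors : ∀ P : (W.baseChange K).toAffine.Point, (2 : ℤ) • P = 0 → P = 0)
    (hrk : (W.baseChange K).mordellWeilRank ≤ 1)
    (y : (W.baseChange K).toAffine.Point) (M : ℕ)
    (hndiv : ∀ Q : (W.baseChange K).toAffine.Point, ((2 ^ (M + 1) : ℕ) : ℤ) • Q ≠ y)
    (hanti : IsOfFinAddOrder (Affine.Point.map (W' := W) (τ : K →ₐ[ℚ] K) y + y))
    (S : AddSubgroup ↥W.sha) [Finite S] :
    Nat.card S ≤ 2 * Nat.card (S.map (shaRestriction W K)) := by
  have hsplit := natCard_eq_natCard_ker_mul_natCard_map S (shaRestriction W K)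
  haveI : Finite ((shaRestriction W K).comp S.subtype).ker := inferInstance
  have hker : Nat.card ((shaRestriction W K).comp S.subtype).ker ≤ 2 := by
    refine natCard_le_two_of_forall_eq fun a b ha hb ↦ ?_
    have ha' : (((a : S) : ↥W.sha) : W.galH1) ≠ 0 := fun h ↦ ha (Subtype.ext (Subtype.ext (Subtype.ext h)))
    have hb' : (((b : S) : ↥W.sha) : W.galH1) ≠ 0 := fun h ↦ hb (Subtype.ext (Subtype.ext (Subtype.ext h)))
    have hra : resBaseChange W K (((a : S) : ↥W.sha) : W.galH1) = 0 := by
      have h := (AddMonoidHom.mem_ker).mp a.2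
      rw [AddMonoidHom.comp_apply, AddSubgroup.coe_subtype] at h
      rw [← coe_shaRestriction_apply, h]; rfl
    have hrb : resBaseChange W K (((b : S) : ↥W.sha) : W.galH1) = 0 := by
      have h := (AddMonoidHom.mem_ker).mp b.2
      rw [AddMonoidHom.comp_apply, AddSubgroup.coe_subtype] at h
      rw [← coe_shaRestriction_apply, h]; rfl
    exact Subtype.ext (Subtype.ext (Subtype.ext
      (eq_of_resBaseChange_eq_zero_of_frame W K h2 hτ h2tors hrk y M hndiv hanti ha' hb' hra hrb)))
  calc Nat.card S = Nat.card ((shaRestriction W K).comp S.subtype).ker * Nat.card (S.map (shaRestriction W K)) := hsplit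
    _ ≤ 2 * Nat.card (S.map (shaRestriction W K)) := Nat.mul_le_mul_right _ hker

/-- **`#Ш(E/ℚ)[2^∞] ≤ 2 · #Ш(E_K/K)[2^∞]`** on the frame (both `2`-primary parts finite): `res` maps `Y` into `X` with `#ker ≤ 2`.
UNCONDITIONAL — this replaces the bound `#Y ≤ #X` that `…OneBitLawKernel` §2 drew from Cassels–Tate `res`/`cor` adjointness.
[cite: Kramer1981, Thm. 1, Prop. 7] [cite: GrossLMS1991, §5 Prop. 5.3] -/
theorem natCard_shaPrimary_rat_le_two_mul_natCard_shaPrimary_of_frame (h2 : Module.finrank ℚ K = 2) {τ : K ≃ₐ[ℚ] K} (hτ : τ ≠ 1)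
    (h2tors : ∀ P : (W.baseChange K).toAffine.Point, (2 : ℤ) • P = 0 → P = 0)
    (hrk : (W.baseChange K).mordellWeilRank ≤ 1)
    (y : (W.baseChange K).toAffine.Point) (M : ℕ)
    (hndiv : ∀ Q : (W.baseChange K).toAffine.Point, ((2 ^ (M + 1) : ℕ) : ℤ) • Q ≠ y)
    (hanti : IsOfFinAddOrder (Affine.Point.map (W' := W) (τ : K →ₐ[ℚ] K) y + y))
    [Finite (AddCommGroup.primaryComponent (↥W.sha) 2)] [Finite (AddCommGroup.primaryComponent (↥(W.baseChange K).sha) 2)] :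
    Nat.card (AddCommGroup.primaryComponent (↥W.sha) 2) ≤ 2 * Nat.card (AddCommGroup.primaryComponent (↥(W.baseChange K).sha) 2) := by
  set Y : AddSubgroup ↥W.sha := AddCommGroup.primaryComponent (↥W.sha) 2 with hY
  set X : AddSubgroup ↥(W.baseChange K).sha := AddCommGroup.primaryComponent (↥(W.baseChange K).sha) 2 with hX
  have hle : Y.map (shaRestriction W K) ≤ X := by
    rintro _ ⟨z, hz, rfl⟩
    obtain ⟨k, hk⟩ := (AddCommGroup.mem_primaryComponent).mp hz
    exact (AddCommGroup.mem_primaryComponent).mpr ⟨k, by rw [← map_nsmul, hk, map_zero]⟩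
  calc Nat.card Y ≤ 2 * Nat.card (Y.map (shaRestriction W K)) :=
        natCard_le_two_mul_natCard_map_shaRestriction_of_frame W K h2 hτ h2tors hrk y M hndiv hanti Y
    _ ≤ 2 * Nat.card X := Nat.mul_le_mul_left 2 (AddSubgroup.card_le_of_le hle)

/-- **`#Ш(E/ℚ)[2] ≤ 2 · #Ш(E_K/K)[2]`** on the frame (when `Ш(E_K/K)[2]` is finite): `res` maps `2`-torsion to `2`-torsion with
`#ker ≤ 2`. UNCONDITIONAL. [cite: Kramer1981, Thm. 1, Prop. 7] -/
theorem natCard_shaTorsionBy_two_rat_le_two_mul_of_frame (h2 : Module.finrank ℚ K = 2) {τ : K ≃ₐ[ℚ] K} (hτ : τ ≠ 1)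
    (h2tors : ∀ P : (W.baseChange K).toAffine.Point, (2 : ℤ) • P = 0 → P = 0)
    (hrk : (W.baseChange K).mordellWeilRank ≤ 1)
    (y : (W.baseChange K).toAffine.Point) (M : ℕ)
    (hndiv : ∀ Q : (W.baseChange K).toAffine.Point, ((2 ^ (M + 1) : ℕ) : ℤ) • Q ≠ y)
    (hanti : IsOfFinAddOrder (Affine.Point.map (W' := W) (τ : K →ₐ[ℚ] K) y + y))
    [Finite (AddSubgroup.torsionBy (↥W.sha) ((2 : ℕ) : ℤ))] [Finite (AddSubgroup.torsionBy (↥(W.baseChange K).sha) ((2 : ℕ) : ℤ))] :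
    Nat.card (AddSubgroup.torsionBy (↥W.sha) ((2 : ℕ) : ℤ)) ≤ 2 * Nat.card (AddSubgroup.torsionBy (↥(W.baseChange K).sha) ((2 : ℕ) : ℤ)) := by
  set TY : AddSubgroup ↥W.sha := AddSubgroup.torsionBy (↥W.sha) ((2 : ℕ) : ℤ) with hTY
  set TX : AddSubgroup ↥(W.baseChange K).sha := AddSubgroup.torsionBy (↥(W.baseChange K).sha) ((2 : ℕ) : ℤ) with hTX
  have hle : TY.map (shaRestriction W K) ≤ TX := by
    rintro _ ⟨z, hz, rfl⟩
    exact AddSubgroup.torsionBy.nsmul_iff.mpr (by rw [← map_nsmul, AddSubgroup.torsionBy.nsmul_iff.mp hz, map_zero])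
  calc Nat.card TY ≤ 2 * Nat.card (TY.map (shaRestriction W K)) :=
        natCard_le_two_mul_natCard_map_shaRestriction_of_frame W K h2 hτ h2tors hrk y M hndiv hanti TY
    _ ≤ 2 * Nat.card TX := Nat.mul_le_mul_left 2 (AddSubgroup.card_le_of_le hle)

end Frame

/-! ## §2 ★ The consistency law `#Ш(E/K)[2^∞] = #Ш(E/ℚ)[2^∞]` WITHOUT `hRC` -/

section Law

/-- `#Ш(E/ℚ)[2^∞] = 4^a` (Cassels–Tate over `ℚ`, unconditional in the tree). [cite: SilvermanAEC2009, Thm. X.4.14] -/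
theorem exists_natCard_shaPrimary_rat_eq_pow [Finite (AddCommGroup.primaryComponent (↥W.sha) 2)] :
    ∃ a : ℕ, Nat.card (AddCommGroup.primaryComponent (↥W.sha) 2) = 2 ^ (2 * a) := by
  haveI : Fact (Nat.Prime 2) := ⟨Nat.prime_two⟩
  obtain ⟨e', he'⟩ := exists_natCard_addPrimaryComponent_eq_pow (A := ↥W.sha) 2
  obtain ⟨r, hr⟩ := CasselsTateNumberField.isSquare_natCard_primaryComponent_sha W 2
  have hr2 : r * r = 2 ^ e' := by rw [← hr, he']
  obtain ⟨a, -, rfl⟩ := (Nat.dvd_prime_pow Nat.prime_two).mp (⟨r, hr2.symm⟩ : r ∣ 2 ^ e')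
  exact ⟨a, by rw [hr, ← pow_add, two_mul]⟩

/-- ★ **THE K₄/K₄⁺ CONSISTENCY LAW, UNCONDITIONAL ON THE FRAME: `#Ш(E/K)[2^∞] = #Ш(E/ℚ)[2^∞]`** on a one-block cell
(`#Ш(E_K/K)[2] = 4`) of the pair-sandwich frame (`K` imaginary quadratic, `σ ≠ 1`, `E(K)[2] = 0`, `rank E(K) ≤ 1`, `y ∈ E(K)` with
`σy + y` torsion and `2^(M+1) ∤ y`, the twin `T = W.quadraticTwist (discr K)` with `Ш(T/ℚ)[2^∞] = 0`) where some non-zero `2`-primary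
class of `Ш(E/ℚ)` dies in `Ш(E_K/K)` (the capitulating class: K₄ / K₄⁺).  = g28's
`natCard_shaPrimary_eq_natCard_shaPrimary_rat_of_adjoint_of_kramerClass_mem_of_frame` with the hypothesis `hRC`
(`casselsTate_pairing_resCor`, Fisher 2003 Prop. 2.16) DELETED.  Proof: `#Y ≤ 2·#X` (§1), `2·#X ≤ 4·#Y`
(`OneBit.two_mul_natCard_shaPrimary_le_of_kramerClass_mem`, cor binders from `corBaseChange_mem_sha`), `#X = 4^t`, `#Y = 4^a`
(Cassels–Tate over `K` / over `ℚ`): parity of exponents gives `a ≤ t ≤ a`.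
[cite: Kramer1981, Thm. 1, Prop. 7, Thm. 2] [cite: Cassels1962ArithmeticIV, §1] [cite: SilvermanAEC2009, Thm. X.4.14] -/
theorem natCard_shaPrimary_eq_natCard_shaPrimary_rat_of_kramerClass_mem_of_frame (hIQ : IsImaginaryQuadratic K)
    {σ : K ≃ₐ[ℚ] K} (hσ1 : σ ≠ 1)
    (h2tors : ∀ P : (W.baseChange K).toAffine.Point, (2 : ℤ) • P = 0 → P = 0)
    (hrk : (W.baseChange K).mordellWeilRank ≤ 1)
    (y : (W.baseChange K).toAffine.Point) (M : ℕ)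
    (hndiv : ∀ Q : (W.baseChange K).toAffine.Point, ((2 ^ (M + 1) : ℕ) : ℤ) • Q ≠ y)
    (hanti : IsOfFinAddOrder (Affine.Point.map (W' := W) (σ : K →ₐ[ℚ] K) y + y))
    [Finite (AddCommGroup.primaryComponent (↥W.sha) 2)] [Finite (AddCommGroup.primaryComponent (↥(W.baseChange K).sha) 2)]
    (hT0 : ∀ x ∈ AddCommGroup.primaryComponent (↥(W.quadraticTwist (NumberField.discr K : ℚ)).sha) 2, x = 0)
    (hKr : ∃ η : W.galH1, η ∈ (AddCommGroup.primaryComponent (↥W.sha) 2).map W.sha.subtype ∧ η ≠ 0 ∧ resBaseChange W K η = 0)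
    (hX4 : Nat.card (AddSubgroup.torsionBy (↥(W.baseChange K).sha) ((2 : ℕ) : ℤ)) = 4) :
    Nat.card (AddCommGroup.primaryComponent (↥(W.baseChange K).sha) 2) = Nat.card (AddCommGroup.primaryComponent (↥W.sha) 2) := by
  haveI : Fact (Nat.Prime 2) := ⟨Nat.prime_two⟩
  -- `#Y ≤ 2·#X` (§1, unconditional)
  have hYX := natCard_shaPrimary_rat_le_two_mul_natCard_shaPrimary_of_frame W K hIQ.1 hσ1 h2tors hrk y M hndiv hanti
  -- `2·#X ≤ 4·#Y` (g27, cor binders by g28)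
  have hge := two_mul_natCard_shaPrimary_le_of_kramerClass_mem W K hIQ hσ1 hT0 (corBaseChange_mem_sha K _ hIQ.1 hσ1)
    (corBaseChange_mem_sha K W hIQ.1 hσ1) hKr
  rw [hX4] at hge
  -- both are powers of `4`
  obtain ⟨t, ht⟩ := exists_natCard_shaPrimary_baseChange_eq_pow W K
  obtain ⟨a, ha⟩ := exists_natCard_shaPrimary_rat_eq_pow W
  rw [ht, ha] at hYX hge ⊢
  have h1 : a ≤ t := le_of_pow_four_le_two_mul_pow_four hYX
  have h2' : 2 ^ (2 * t) ≤ 2 * 2 ^ (2 * a) := by omega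
  have h2 : t ≤ a := le_of_pow_four_le_two_mul_pow_four h2'
  congr 1
  omega

end Law

/-! ## §3 The common one-block structure: `Ш(E_K/K)[2^∞] ≃ Ш(E/ℚ)[2^∞] ≃ ℤ/2^e × ℤ/2^e`, `#Ш(E/ℚ)[2] = 4` -/

section Structure

/-- **`#Ш(E/ℚ)[2] = 4` on a one-block cell with a capitulating class** (frame as in §2): `#Ш(E/ℚ)[2] ≤ 2·#Ш(E_K/K)[2] = 8` (§1 on the
`2`-torsion), `#Ш(E/ℚ)[2]` is a square (Cassels–Tate over `ℚ`), and `Ш(E/ℚ)[2] ≠ 0` (the capitulating class is a non-zero `2`-power-torsion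
class, so one of its multiples is a non-zero `2`-torsion class). [cite: Cassels1962ArithmeticIV, §1] [cite: Kramer1981, Thm. 1, Prop. 7] -/
theorem natCard_shaTorsionBy_two_rat_eq_four_of_kramerClass_mem_of_frame (h2 : Module.finrank ℚ K = 2) {τ : K ≃ₐ[ℚ] K} (hτ : τ ≠ 1)
    (h2tors : ∀ P : (W.baseChange K).toAffine.Point, (2 : ℤ) • P = 0 → P = 0)
    (hrk : (W.baseChange K).mordellWeilRank ≤ 1)
    (y : (W.baseChange K).toAffine.Point) (M : ℕ)
    (hndiv : ∀ Q : (W.baseChange K).toAffine.Point, ((2 ^ (M + 1) : ℕ) : ℤ) • Q ≠ y)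
    (hanti : IsOfFinAddOrder (Affine.Point.map (W' := W) (τ : K →ₐ[ℚ] K) y + y))
    [Finite (AddCommGroup.primaryComponent (↥W.sha) 2)] [Finite (AddCommGroup.primaryComponent (↥(W.baseChange K).sha) 2)]
    (hKr : ∃ η : W.galH1, η ∈ (AddCommGroup.primaryComponent (↥W.sha) 2).map W.sha.subtype ∧ η ≠ 0 ∧ resBaseChange W K η = 0)
    (hX4 : Nat.card (AddSubgroup.torsionBy (↥(W.baseChange K).sha) ((2 : ℕ) : ℤ)) = 4) :
    Nat.card (AddSubgroup.torsionBy (↥W.sha) ((2 : ℕ) : ℤ)) = 4 := by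
  haveI : Fact (Nat.Prime 2) := ⟨Nat.prime_two⟩
  haveI hell : (W.baseChange K).IsElliptic := inferInstanceAs ((W.map (algebraMap ℚ K)).IsElliptic)
  set Y : AddSubgroup ↥W.sha := AddCommGroup.primaryComponent (↥W.sha) 2 with hY
  set X : AddSubgroup ↥(W.baseChange K).sha := AddCommGroup.primaryComponent (↥(W.baseChange K).sha) 2 with hX
  -- the `2`-torsion sits inside the (finite) `2`-primary parts
  have hTYle : AddSubgroup.torsionBy (↥W.sha) ((2 : ℕ) : ℤ) ≤ Y := fun z hz ↦
    (AddCommGroup.mem_primaryComponent).mpr ⟨1, by rw [pow_one]; exact AddSubgroup.torsionBy.nsmul_iff.mp hz⟩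
  have hTXle : AddSubgroup.torsionBy (↥(W.baseChange K).sha) ((2 : ℕ) : ℤ) ≤ X := fun z hz ↦
    (AddCommGroup.mem_primaryComponent).mpr ⟨1, by rw [pow_one]; exact AddSubgroup.torsionBy.nsmul_iff.mp hz⟩
  haveI : Finite (AddSubgroup.torsionBy (↥W.sha) ((2 : ℕ) : ℤ)) :=
    Finite.of_injective (AddSubgroup.inclusion hTYle) (AddSubgroup.inclusion_injective hTYle)
  haveI : Finite (AddSubgroup.torsionBy (↥(W.baseChange K).sha) ((2 : ℕ) : ℤ)) :=
    Finite.of_injective (AddSubgroup.inclusion hTXle) (AddSubgroup.inclusion_injective hTXle)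
  -- upper bound `≤ 8`
  have hle8 : Nat.card (AddSubgroup.torsionBy (↥W.sha) ((2 : ℕ) : ℤ)) ≤ 8 := by
    have h := natCard_shaTorsionBy_two_rat_le_two_mul_of_frame W K h2 hτ h2tors hrk y M hndiv hanti
    rw [hX4] at h
    exact h
  -- a square
  obtain ⟨r, hr⟩ : IsSquare (Nat.card (AddSubgroup.torsionBy (↥W.sha) ((2 : ℕ) : ℤ))) := by
    have h := CasselsTateNumberField.natCard_sha_torsionBy_pow_eq_primaryComponent W 2 1
    rw [pow_one] at h
    rw [h]
    exact CasselsTateNumberField.isSquare_natCard_primaryComponent_sha_torsionBy W 2 2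
  -- non-trivial: a multiple of the capitulating class is a non-zero `2`-torsion class
  have hge2 : 2 ≤ Nat.card (AddSubgroup.torsionBy (↥W.sha) ((2 : ℕ) : ℤ)) := by
    obtain ⟨η, hηY, hη0, -⟩ := hKr
    obtain ⟨yy, hyy, rfl⟩ := AddSubgroup.mem_map.mp hηY
    obtain ⟨k, hk⟩ := (AddCommGroup.mem_primaryComponent).mp hyy
    have hyy0 : yy ≠ 0 := fun h ↦ hη0 (by rw [h]; rfl)
    obtain ⟨j, hj0, hj2⟩ := exists_nsmul_ne_zero_two_nsmul_eq_zero hyy0 hk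
    have hmem : (2 ^ j • yy) ∈ AddSubgroup.torsionBy (↥W.sha) ((2 : ℕ) : ℤ) := AddSubgroup.torsionBy.nsmul_iff.mpr hj2
    have hnt : Nontrivial (AddSubgroup.torsionBy (↥W.sha) ((2 : ℕ) : ℤ)) :=
      ⟨⟨⟨2 ^ j • yy, hmem⟩, 0, fun h ↦ hj0 (congrArg Subtype.val h)⟩⟩
    exact Finite.one_lt_card_iff_nontrivial.mpr hnt
  -- `r² ∈ [2, 8]` forces `r = 2`
  rw [hr] at hle8 hge2 ⊢
  have hr3 : r < 3 := by nlinarith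
  have hr1 : 1 < r := by nlinarith
  interval_cases r
  rfl

/-- **THE COMMON ONE-BLOCK STRUCTURE.**  On a one-block cell (`#Ш(E_K/K)[2] = 4`) of the pair-sandwich frame with a capitulating class and
a twin with `Ш(T/ℚ)[2^∞] = 0`: **there is ONE `e ≥ 1` with `Ш(E_K/K)[2^∞] ≃ ℤ/2^e × ℤ/2^e`, `Ш(E/ℚ)[2^∞] ≃ ℤ/2^e × ℤ/2^e` and
`#Ш(E_K/K)[2^∞] = #Ш(E/ℚ)[2^∞] = 4^e`** — hyperbolicity of both `2`-primary parts (Cassels–Tate/Wall, tree theorems over every number field),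
`#X[2] = 4`, `#Y[2] = 4` (previous theorem), `KFourCell.exists_addEquiv_zmod_prod_zmod_of_natCard_torsionBy_two_eq_four`, and §2 for the
common exponent.  Reading: on the K₄ / K₄⁺ cells BOTH Tate–Shafarevich groups are a single Kolyvagin–McCallum block of the SAME size; U_T
(`e ≤ M₀` over `K`) and B₂ (`e ≤ M₀` over `ℚ`) coincide, BSD predicts `e = M₀` on both sides at once.  Nothing here computes `e`.
[cite: Cassels1962ArithmeticIV, §1] [cite: Wall1963QuadraticFormsFiniteGroups, Lemma 7] [cite: McCallumLMS1991, §5] [cite: Kramer1981, Thm. 1] -/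
theorem exists_addEquiv_shaPrimary_prod_of_kramerClass_mem_of_frame (hIQ : IsImaginaryQuadratic K)
    {σ : K ≃ₐ[ℚ] K} (hσ1 : σ ≠ 1)
    (h2tors : ∀ P : (W.baseChange K).toAffine.Point, (2 : ℤ) • P = 0 → P = 0)
    (hrk : (W.baseChange K).mordellWeilRank ≤ 1)
    (y : (W.baseChange K).toAffine.Point) (M : ℕ)
    (hndiv : ∀ Q : (W.baseChange K).toAffine.Point, ((2 ^ (M + 1) : ℕ) : ℤ) • Q ≠ y)
    (hanti : IsOfFinAddOrder (Affine.Point.map (W' := W) (σ : K →ₐ[ℚ] K) y + y))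
    [Finite (AddCommGroup.primaryComponent (↥W.sha) 2)] [Finite (AddCommGroup.primaryComponent (↥(W.baseChange K).sha) 2)]
    (hT0 : ∀ x ∈ AddCommGroup.primaryComponent (↥(W.quadraticTwist (NumberField.discr K : ℚ)).sha) 2, x = 0)
    (hKr : ∃ η : W.galH1, η ∈ (AddCommGroup.primaryComponent (↥W.sha) 2).map W.sha.subtype ∧ η ≠ 0 ∧ resBaseChange W K η = 0)
    (hX4 : Nat.card (AddSubgroup.torsionBy (↥(W.baseChange K).sha) ((2 : ℕ) : ℤ)) = 4) :
    ∃ e : ℕ, 1 ≤ e ∧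
      Nonempty (AddCommGroup.primaryComponent (↥(W.baseChange K).sha) 2 ≃+ ZMod (2 ^ e) × ZMod (2 ^ e)) ∧
      Nonempty (AddCommGroup.primaryComponent (↥W.sha) 2 ≃+ ZMod (2 ^ e) × ZMod (2 ^ e)) ∧
      Nat.card (AddCommGroup.primaryComponent (↥(W.baseChange K).sha) 2) = 4 ^ e ∧
      Nat.card (AddCommGroup.primaryComponent (↥W.sha) 2) = 4 ^ e := by
  haveI : Fact (Nat.Prime 2) := ⟨Nat.prime_two⟩
  haveI hell : (W.baseChange K).IsElliptic := inferInstanceAs ((W.map (algebraMap ℚ K)).IsElliptic)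
  -- every element of a `2`-primary component is `2`-power torsion
  have hGX : ∀ g : AddCommGroup.primaryComponent (↥(W.baseChange K).sha) 2, ∃ k : ℕ, 2 ^ k • g = 0 := fun g ↦ by
    obtain ⟨k, hk⟩ := (AddCommGroup.mem_primaryComponent).mp g.2
    exact ⟨k, Subtype.ext (by rw [AddSubgroupClass.coe_nsmul, ZeroMemClass.coe_zero]; exact hk)⟩
  have hGY : ∀ g : AddCommGroup.primaryComponent (↥W.sha) 2, ∃ k : ℕ, 2 ^ k • g = 0 := fun g ↦ by
    obtain ⟨k, hk⟩ := (AddCommGroup.mem_primaryComponent).mp g.2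
    exact ⟨k, Subtype.ext (by rw [AddSubgroupClass.coe_nsmul, ZeroMemClass.coe_zero]; exact hk)⟩
  -- `#X[2] = 4`, `#Y[2] = 4`, transported to the primary components
  have hX4' : Nat.card (AddSubgroup.torsionBy (AddCommGroup.primaryComponent (↥(W.baseChange K).sha) 2) ((2 : ℕ) : ℤ)) = 4 := by
    have h := CasselsTateNumberField.natCard_sha_torsionBy_pow_eq_primaryComponent (W.baseChange K) 2 1
    rw [pow_one] at h
    rw [← h]; exact hX4
  have hY4 := natCard_shaTorsionBy_two_rat_eq_four_of_kramerClass_mem_of_frame W K hIQ.1 hσ1 h2tors hrk y M hndiv hanti hKr hX4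
  have hY4' : Nat.card (AddSubgroup.torsionBy (AddCommGroup.primaryComponent (↥W.sha) 2) ((2 : ℕ) : ℤ)) = 4 := by
    have h := CasselsTateNumberField.natCard_sha_torsionBy_pow_eq_primaryComponent W 2 1
    rw [pow_one] at h
    rw [← h]; exact hY4
  -- hyperbolicity (Cassels–Tate over `K` and over `ℚ`)
  obtain ⟨LX, ⟨eLX⟩⟩ := CasselsTateNumberField.exists_addEquiv_prod_self_primaryComponent_sha (W.baseChange K) 2
  obtain ⟨LY, ⟨eLY⟩⟩ := CasselsTateNumberField.exists_addEquiv_prod_self_primaryComponent_sha W 2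
  obtain ⟨e, ⟨eX⟩, hXe⟩ := KFourCell.exists_addEquiv_zmod_prod_zmod_of_natCard_torsionBy_two_eq_four hGX eLX hX4'
  obtain ⟨e', ⟨eY⟩, hYe'⟩ := KFourCell.exists_addEquiv_zmod_prod_zmod_of_natCard_torsionBy_two_eq_four hGY eLY hY4'
  -- the common exponent (§2)
  have heq := natCard_shaPrimary_eq_natCard_shaPrimary_rat_of_kramerClass_mem_of_frame W K hIQ hσ1 h2tors hrk y M hndiv hanti hT0 hKr hX4
  rw [hXe, hYe'] at heq
  obtain rfl : e = e' := Nat.pow_right_injective (by norm_num : 2 ≤ 4) heq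
  -- `e ≥ 1`: `Y` contains the non-zero capitulating class
  have he1 : 1 ≤ e := by
    by_contra h0
    have he0 : e = 0 := by omega
    obtain ⟨η, hηY, hη0, -⟩ := hKr
    obtain ⟨yy, hyy, rfl⟩ := AddSubgroup.mem_map.mp hηY
    haveI : Subsingleton (AddCommGroup.primaryComponent (↥W.sha) 2) := by
      apply (Nat.card_eq_one_iff_unique.mp (by rw [hYe', he0, pow_zero])).1
    have h0 : (⟨yy, hyy⟩ : AddCommGroup.primaryComponent (↥W.sha) 2) = 0 := Subsingleton.elim _ _
    exact hη0 (by rw [show yy = 0 from congrArg Subtype.val h0]; rfl)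
  exact ⟨e, he1, ⟨eX⟩, ⟨eY⟩, hXe, hYe'⟩

end Structure

end Summit.BirchSwinnertonDyer.BirchSwinnertonDyer.Theorems.GenusExact.ShaCores

end
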